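import Literature.MathematicalPhysics.KineticTheory.LangevinChainH2Proof
import HarnessLib

/-!
# CEHR Theorem 5.1 / Remark 5.2 (H2) for the pinned chain with constants UNIFORM in the bath temperatures

Helper file (`--supports`) for item stmt-AtomisticToContinuum-14071 (`CorrectorTheory`, route
`OddSectorIrreversibility`, sub-problem `FouriersLaw` of `AtomisticToContinuum`). Conjunct B of that item
(the open-chain Green–Kubo identity) is reduced in the tree to the exponential convergence (2.5) of
Cuneo–Eckmann–Hairer–Rey-Bellet 2018 for the kernels with baths at `T ± δ/2` with constants UNIFORM in
`|δ| ≤ δ₀` (`OpenChainGreenKubo.openChainGreenKubo_of_uniformDecay`,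
`responseDensity_of_uniformMixing`). The first input of a uniform Harris bound is a uniform Lyapunov
condition. The tree's discharge `CuneoEckmannHairerReyBellet2018_H2_holds` (`LangevinChainH2Proof.lean`)
is explicit: its energy threshold depends on the temperatures only through `√(2γT_L) + √(2γT_R)`,
`exp(θγ(T_L+T_R)t*)` and `max(T_L,T_R)`, all monotone. Re-running that assembly with a temperature
CEILING `Tmax` gives:

* `pinnedChain_decay_uniform` — for `0 < θ < 1/Tmax` and `t* > 0` there is ONE energy threshold `E₁`
  such that `P_{t*} e^{θH}(z) ≤ e^{θH(z)}/2` for `H(z) ≥ E₁`, for ALL bath temperatures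
  `0 < T_L, T_R ≤ Tmax`;
* `pinnedChain_drift_uniform` — hence the geometric drift `P_{t*} e^{θH} ≤ e^{θH}/2 + c` with ONE
  constant `c = e^{2θγ Tmax t*} e^{θE₁}` for all such temperatures (Remark 5.2, uniform form).

No definitions, no named facts.
-/

noncomputable section

open MeasureTheory ProbabilityTheory Filter Topology Set Metric Function
open scoped NNReal ENNReal

namespace Summit.AtomisticToContinuum.FouriersLaw.Theorems.OddSectorIrreversibility.Corrector

open Literature.MathematicalPhysics.KineticTheory.HeatConduction
open Literature.Probability.Process OscillatorChain Literature.Analysis.ODE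
open Literature.MathematicalPhysics.KineticTheory

variable {N : ℕ}

/-- `|√(2γT)| ≤ |√(2γTmax)|` for `T ≤ Tmax` (`γ > 0`). [folklore] -/
theorem abs_sqrt_amp_le {γ Tmax T : ℝ} (hγ : 0 < γ) (hT : T ≤ Tmax) :
    |Real.sqrt (2 * γ * T)| ≤ |Real.sqrt (2 * γ * Tmax)| := by
  rw [abs_of_nonneg (Real.sqrt_nonneg _), abs_of_nonneg (Real.sqrt_nonneg _)]
  exact Real.sqrt_le_sqrt (by nlinarith [hγ.le])

section Uniform

variable {ω₂ lam β γ : ℝ} (hω : 0 < ω₂) (hl : 0 ≤ lam) (hβ : 0 < β) (hγ : 0 < γ) (hN : 0 < N)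
  {Tmax : ℝ} (hTmax : 0 < Tmax)
include hω hl hβ hγ hN hTmax

set_option maxHeartbeats 3200000 in
/-- **CEHR Theorem 5.1 with a temperature ceiling: ONE energy threshold for all baths at
`0 < T_L, T_R ≤ Tmax`.** For the transition kernels of `pinnedChain ω₂ lam β γ` (`ω₂, β, γ > 0`,
`lam ≥ 0`, `N ≥ 1`), every `0 < θ < 1/Tmax` and every `t* > 0` there is `E₁` such that
`P_{t*} e^{θH}(z) ≤ e^{θH(z)}/2` whenever `H(z) ≥ E₁`, simultaneously for all bath temperatures
`T_L, T_R ∈ (0, Tmax]`. Proof: the assembly of `CuneoEckmannHairerReyBellet2018_H2_holds` verbatim,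
with the noise-size constant `√(2γT_L) + √(2γT_R) + 1` replaced by its value at `Tmax`, the a-priori
factor `exp(θγ(T_L+T_R)t*)` by `exp(2θγ Tmax t*)` and the Hölder exponent chosen from `θ Tmax`; the
two dissipation packages do not see the temperatures.
[cite: CuneoEckmannHairerReyBellet2018, Thm 5.1 and Rem 5.2 (proof)] -/
theorem pinnedChain_decay_uniform {θ : ℝ} (hθ : 0 < θ) (hθ' : θ < 1 / Tmax) (tstar : ℝ≥0)
    (htstar : 0 < tstar) :
    ∃ E₁ : ℝ, ∀ T_L T_R : ℝ, 0 < T_L → 0 < T_R → T_L ≤ Tmax → T_R ≤ Tmax →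
      ∀ z : PhaseSpace N, E₁ ≤ (pinnedChain ω₂ lam β γ).hamiltonian N z →
        ∫⁻ y, ENNReal.ofReal (Real.exp (θ * (pinnedChain ω₂ lam β γ).hamiltonian N y))
            ∂((pinnedChain ω₂ lam β γ).transitionKernel N T_L T_R tstar z) ≤
          ENNReal.ofReal (Real.exp (θ * (pinnedChain ω₂ lam β γ).hamiltonian N z) / 2) := by
  -- the Hölder exponent `p` with `1 < p`, `pθ < 1/Tmax`
  have hθT0 : 0 < θ * Tmax := mul_pos hθ hTmax
  have hθT : θ * Tmax < 1 := by rwa [lt_div_iff₀ hTmax] at hθ'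
  obtain ⟨p, hpdef⟩ : ∃ p : ℝ, p = (1 / (θ * Tmax) + 1) / 2 := ⟨_, rfl⟩
  have hp1 : 1 < p := by
    have h1 : 1 < 1 / (θ * Tmax) := by rw [lt_div_iff₀ hθT0]; linarith only [hθT]
    rw [hpdef]; linarith only [h1]
  have hpθ : p * θ < 1 / Tmax := by
    rw [hpdef, lt_div_iff₀ hTmax]
    have e : (1 / (θ * Tmax) + 1) / 2 * θ * Tmax = (1 + θ * Tmax) / 2 := by
      field_simp
    rw [e]; linarith only [hθT]
  have hr0 : 0 < 1 - p⁻¹ := by have := inv_lt_one_of_one_lt₀ hp1; linarith only [this]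
  -- the constants of the energy estimates
  set A := pinnedChainScaleA γ N with hA
  have hA1 : 1 ≤ A := one_le_pinnedChainScaleA hγ.le N
  set c₁ := pinnedChainScaleC ω₂ lam β γ N with hc₁
  set B := pinnedChainScaleB ω₂ lam β γ N with hB
  have hc₁0 : 0 ≤ c₁ := pinnedChainScaleC_nonneg hω.le hl hβ.le hγ.le N
  have hB0 : 0 ≤ B := pinnedChainScaleB_nonneg hω.le hl hβ.le hγ.le N
  obtain ⟨CI, hCI⟩ : ∃ CI : ℝ, CI = (A * c₁ + B) + N * (c₁ + 1 / 2) + N / 2 := ⟨_, rfl⟩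
  have hCI0 : 0 ≤ CI := by rw [hCI]; positivity
  -- the noise-size constant AT THE CEILING
  obtain ⟨cs, hcs⟩ : ∃ cs : ℝ, cs = |Real.sqrt (2 * γ * Tmax)| + |Real.sqrt (2 * γ * Tmax)| + 1 := ⟨_, rfl⟩
  have hcs1 : 1 ≤ cs := by
    rw [hcs]; linarith only [abs_nonneg (Real.sqrt (2 * γ * Tmax))]
  -- the decay factor `κ₀` (from the a-priori factor at the ceiling) and the thresholds it induces
  obtain ⟨G, hG⟩ : ∃ G : ℝ, G = Real.exp (θ * γ * (Tmax + Tmax) * tstar) := ⟨_, rfl⟩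
  have hG1 : 1 ≤ G := by
    rw [hG]; apply Real.one_le_exp
    have := hTmax.le; positivity
  obtain ⟨κ₀, hκ₀⟩ : ∃ κ₀ : ℝ, κ₀ = 1 / (2 * G) := ⟨_, rfl⟩
  have hκ₀0 : 0 < κ₀ := by rw [hκ₀]; positivity
  have hκ₀1 : κ₀ ≤ 1 / 2 := by
    rw [hκ₀, div_le_div_iff₀ (by positivity) (by norm_num)]; linarith only [hG1]
  have hκG : κ₀ * Real.exp (θ * γ * (Tmax + Tmax) * tstar) ≤ 1 / 2 := by
    rw [← hG, hκ₀]
    have hG0 : G ≠ 0 := by linarith only [hG1]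
    have e : 1 / (2 * G) * G = 1 / 2 := by field_simp
    rw [e]
  obtain ⟨L₀, hL₀⟩ : ∃ L₀ : ℝ, L₀ = Real.log (2 / κ₀) := ⟨_, rfl⟩
  have hL₀0 : 0 ≤ L₀ := by
    rw [hL₀]; apply Real.log_nonneg; rw [le_div_iff₀ hκ₀0]; linarith only [hκ₀1]
  obtain ⟨y₀, hy₀⟩ : ∃ y₀ : ℝ, y₀ = κ₀ / (2 * G) := ⟨_, rfl⟩
  have hy₀0 : 0 < y₀ := by rw [hy₀]; positivity
  obtain ⟨x₀, hx₀⟩ : ∃ x₀ : ℝ, x₀ = y₀ ^ (1 - p⁻¹)⁻¹ := ⟨_, rfl⟩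
  have hx₀0 : 0 < x₀ := by rw [hx₀]; exact Real.rpow_pos_of_pos hy₀0 _
  -- the noise size `δ₀` of the dissipation lemmas and the pinning window
  obtain ⟨δ₀, hδ₀⟩ : ∃ δ₀ : ℝ, δ₀ = 1 / (A + 1) := ⟨_, rfl⟩
  have hδ₀0 : 0 < δ₀ := by rw [hδ₀]; positivity
  have hδ₀1 : δ₀ ≤ 1 := by rw [hδ₀, div_le_one (by positivity)]; linarith only [hA1]
  have hAδ : A * δ₀ * 1 ≤ 1 := by
    rw [hδ₀, mul_one, mul_one_div, div_le_one (by positivity)]; linarith only [hA1]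
  obtain ⟨T₂, hT₂⟩ : ∃ T₂ : ℝ, T₂ = min (tstar : ℝ) 1 := ⟨_, rfl⟩
  have hT₂0 : 0 < T₂ := by rw [hT₂]; exact lt_min (by exact_mod_cast htstar) one_pos
  have hT₂1 : T₂ ≤ 1 := by rw [hT₂]; exact min_le_right _ _
  have hT₂t : T₂ ≤ tstar := by rw [hT₂]; exact min_le_left _ _
  have hAδ₂ : A * δ₀ * T₂ ≤ 1 := (mul_le_mul_of_nonneg_left hT₂1 (by positivity)).trans hAδ
  -- the two dissipation packages (interaction regime; pinning regime for `lam = 0`)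
  obtain ⟨KI, εI, hKI1, hεI, hI⟩ := pinnedChain_dissipation_ge_interaction (ω₂ := ω₂) (lam := lam) (β := β)
    (γ := γ) hω hl hβ hγ hN (Λ := 1) one_pos hδ₀0 hδ₀1 hAδ
  obtain ⟨KII, εII, hKII1, hεII, hII⟩ := pinnedChain_dissipation_ge_pinning (ω₂ := ω₂) (β := β) (γ := γ)
    hω hβ hγ hN hT₂0 hδ₀0 hδ₀1 hAδ₂
  obtain ⟨CΦ, hCΦ⟩ : ∃ CΦ : ℝ, CΦ = N * (ω₂ * max 1 (8 / lam) + max 1 (8 / β)) / 2 := ⟨_, rfl⟩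
  have hCΦ0 : 0 ≤ CΦ := by rw [hCΦ]; positivity
  -- the scale threshold `K₅` and the energy threshold `E₁ = K₅⁴`
  obtain ⟨K₅, hK₅⟩ : ∃ K₅ : ℝ, K₅ = 1 + KI + KII + (2 * CΦ + 1) + (A + 1) ^ 2 + 1 / (tstar : ℝ) +
      4 * cs ^ 2 + (2 * CI / εI) ^ 2 + (2 * CI / εII) ^ 2 + 16 * cs ^ 4 / x₀ + 2 * L₀ / (θ * εI) +
      2 * L₀ / (θ * εII) := ⟨_, rfl⟩
  have hts0 : (0 : ℝ) < tstar := by exact_mod_cast htstar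
  have hs1 : 0 ≤ KI := by linarith only [hKI1]
  have hs2 : 0 ≤ KII := by linarith only [hKII1]
  have hs3 : 0 ≤ 2 * CΦ + 1 := by positivity
  have hs4 : 0 ≤ (A + 1) ^ 2 := by positivity
  have hs5 : 0 ≤ 1 / (tstar : ℝ) := by positivity
  have hs6 : 0 ≤ 4 * cs ^ 2 := by positivity
  have hs7 : 0 ≤ (2 * CI / εI) ^ 2 := by positivity
  have hs8 : 0 ≤ (2 * CI / εII) ^ 2 := by positivity
  have hs9 : 0 ≤ 16 * cs ^ 4 / x₀ := by positivity
  have hs10 : 0 ≤ 2 * L₀ / (θ * εI) := by positivity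
  have hs11 : 0 ≤ 2 * L₀ / (θ * εII) := by positivity
  obtain ⟨E₁, hE₁⟩ : ∃ E₁ : ℝ, E₁ = K₅ ^ 4 := ⟨_, rfl⟩
  refine ⟨E₁, fun T_L T_R hTL hTR hTLm hTRm => ?_⟩
  -- the temperatures: comparison with the ceiling
  have hmaxT : max T_L T_R ≤ Tmax := max_le hTLm hTRm
  have hmax0 : 0 < max T_L T_R := lt_max_of_lt_left hTL
  have hθ'' : θ < 1 / max T_L T_R := hθ'.trans_le (one_div_le_one_div_of_le hmax0 hmaxT)
  have hpθ' : p * θ < 1 / max T_L T_R := hpθ.trans_le (one_div_le_one_div_of_le hmax0 hmaxT)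
  have hsum : T_L + T_R ≤ Tmax + Tmax := add_le_add hTLm hTRm
  have hGle : Real.exp (θ * γ * (T_L + T_R) * tstar) ≤ G := by
    rw [hG]
    refine Real.exp_le_exp.2 (mul_le_mul_of_nonneg_right (mul_le_mul_of_nonneg_left hsum ?_) tstar.coe_nonneg)
    positivity
  have hGpos' : 0 < Real.exp (θ * γ * (T_L + T_R) * tstar) := Real.exp_pos _
  have hκG' : κ₀ * Real.exp (θ * γ * (T_L + T_R) * tstar) ≤ 1 / 2 :=
    (mul_le_mul_of_nonneg_left hGle hκ₀0.le).trans (by rw [hG]; exact hκG)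
  have hcsle : |Real.sqrt (2 * γ * T_L)| + |Real.sqrt (2 * γ * T_R)| + 1 ≤ cs := by
    rw [hcs]
    linarith only [abs_sqrt_amp_le hγ hTLm, abs_sqrt_amp_le hγ hTRm]
  have hcs0' : 0 ≤ |Real.sqrt (2 * γ * T_L)| + |Real.sqrt (2 * γ * T_R)| + 1 := by positivity
  refine pinnedChain_decay_of_window hω hl hβ hγ hN hTL hTR hθ hθ'' tstar (E₁ := E₁) (κ₀ := κ₀) hκG' ?_
  intro z hz
  -- the scale of `z`: `K = H(z)^{1/4} ≥ K₅`
  have hHz0 : 0 ≤ (pinnedChain ω₂ lam β γ).hamiltonian N z := pinnedChain_hamiltonian_nonneg hω.le hl hβ.le γ N z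
  obtain ⟨K, hKdef⟩ : ∃ K : ℝ, K = Real.sqrt (Real.sqrt ((pinnedChain ω₂ lam β γ).hamiltonian N z)) := ⟨_, rfl⟩
  have hK4 : K ^ 4 = (pinnedChain ω₂ lam β γ).hamiltonian N z := by
    rw [hKdef, show (4 : ℕ) = 2 * 2 from rfl, pow_mul, Real.sq_sqrt (Real.sqrt_nonneg _), Real.sq_sqrt hHz0]
  have hK₅1 : 1 ≤ K₅ := by rw [hK₅]; linarith only [hs1, hs2, hs3, hs4, hs5, hs6, hs7, hs8, hs9, hs10, hs11]
  have hK5 : K₅ ≤ K := by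
    rw [hKdef, Real.le_sqrt (by linarith only [hK₅1]) (Real.sqrt_nonneg _), Real.le_sqrt (by positivity) hHz0]
    calc (K₅ ^ 2) ^ 2 = E₁ := by rw [hE₁]; ring
      _ ≤ _ := hz
  have hthr : ∀ x : ℝ, x ≤ K₅ → x ≤ K := fun x hx => hx.trans hK5
  have hK1 : 1 ≤ K := hthr 1 (by rw [hK₅]; linarith only [hs1, hs2, hs3, hs4, hs5, hs6, hs7, hs8, hs9, hs10, hs11])
  have hK0 : 0 < K := by linarith only [hK1]
  have hKI : KI ≤ K := hthr _ (by rw [hK₅]; linarith only [hs1, hs2, hs3, hs4, hs5, hs6, hs7, hs8, hs9, hs10, hs11])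
  have hKII : KII ≤ K := hthr _ (by rw [hK₅]; linarith only [hs1, hs2, hs3, hs4, hs5, hs6, hs7, hs8, hs9, hs10, hs11])
  have hKΦ' : 2 * CΦ + 1 ≤ K := hthr _ (by rw [hK₅]; linarith only [hs1, hs2, hs3, hs4, hs5, hs6, hs7, hs8, hs9, hs10, hs11])
  have hKA2 : (A + 1) ^ 2 ≤ K := hthr _ (by rw [hK₅]; linarith only [hs1, hs2, hs3, hs4, hs5, hs6, hs7, hs8, hs9, hs10, hs11])
  have hKt : 1 / (tstar : ℝ) ≤ K := hthr _ (by rw [hK₅]; linarith only [hs1, hs2, hs3, hs4, hs5, hs6, hs7, hs8, hs9, hs10, hs11])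
  have hKcs : 4 * cs ^ 2 ≤ K := hthr _ (by rw [hK₅]; linarith only [hs1, hs2, hs3, hs4, hs5, hs6, hs7, hs8, hs9, hs10, hs11])
  have hKeI : (2 * CI / εI) ^ 2 ≤ K := hthr _ (by rw [hK₅]; linarith only [hs1, hs2, hs3, hs4, hs5, hs6, hs7, hs8, hs9, hs10, hs11])
  have hKeII : (2 * CI / εII) ^ 2 ≤ K := hthr _ (by rw [hK₅]; linarith only [hs1, hs2, hs3, hs4, hs5, hs6, hs7, hs8, hs9, hs10, hs11])
  have hKx : 16 * cs ^ 4 / x₀ ≤ K := hthr _ (by rw [hK₅]; linarith only [hs1, hs2, hs3, hs4, hs5, hs6, hs7, hs8, hs9, hs10, hs11])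
  have hKLI : 2 * L₀ / (θ * εI) ≤ K := hthr _ (by rw [hK₅]; linarith only [hs1, hs2, hs3, hs4, hs5, hs6, hs7, hs8, hs9, hs10, hs11])
  have hKLII : 2 * L₀ / (θ * εII) ≤ K := hthr _ (by rw [hK₅]; linarith only [hs1, hs2, hs3, hs4, hs5, hs6, hs7, hs8, hs9, hs10, hs11])
  have hz1 : K ^ 4 ≤ (pinnedChain ω₂ lam β γ).hamiltonian N z := hK4.le
  have hz2 : (pinnedChain ω₂ lam β γ).hamiltonian N z ≤ 2 * K ^ 4 := by rw [← hK4]; linarith only [pow_nonneg hHz0 1, sq_nonneg (K ^ 2)]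
  -- `M = √K`
  obtain ⟨M, hM⟩ : ∃ M : ℝ, M = Real.sqrt K := ⟨_, rfl⟩
  have hMK : M * M = K := by rw [hM]; exact Real.mul_self_sqrt hK0.le
  have hM1 : 1 ≤ M := by rw [hM, Real.le_sqrt (by norm_num) hK0.le]; simpa using hK1
  have hM0 : 0 < M := by linarith only [hM1]
  have hAM' : A + 1 ≤ M := by rw [hM, Real.le_sqrt (by positivity) hK0.le]; exact hKA2
  have hMδ : M ≤ δ₀ * K := by
    rw [hδ₀, one_div, le_inv_mul_iff₀ (by positivity : 0 < A + 1)]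
    calc (A + 1) * M ≤ M * M := mul_le_mul_of_nonneg_right hAM' hM0.le
      _ = K := hMK
  have hAM : A * M ≤ K := by
    calc A * M ≤ M * M := mul_le_mul_of_nonneg_right (by linarith only [hAM']) hM0.le
      _ = K := hMK
  have hbadK : 16 * cs ^ 4 / K ≤ x₀ := by
    rw [div_le_iff₀ hK0]
    have := hKx
    rw [div_le_iff₀ hx₀0] at this
    linarith only [this]
  -- the two temperature-dependent side conditions, from their values at the ceiling
  have hKcs' : 4 * (|Real.sqrt (2 * γ * T_L)| + |Real.sqrt (2 * γ * T_R)| + 1) ^ 2 ≤ K := by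
    have h1 : (|Real.sqrt (2 * γ * T_L)| + |Real.sqrt (2 * γ * T_R)| + 1) ^ 2 ≤ cs ^ 2 :=
      pow_le_pow_left₀ hcs0' hcsle 2
    linarith only [h1, hKcs]
  have hbadK' : 16 * (|Real.sqrt (2 * γ * T_L)| + |Real.sqrt (2 * γ * T_R)| + 1) ^ 4 / K ≤
      (κ₀ / (2 * Real.exp (θ * γ * (T_L + T_R) * tstar))) ^ (1 - p⁻¹)⁻¹ := by
    have h1 : (|Real.sqrt (2 * γ * T_L)| + |Real.sqrt (2 * γ * T_R)| + 1) ^ 4 ≤ cs ^ 4 :=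
      pow_le_pow_left₀ hcs0' hcsle 4
    have h2 : 16 * (|Real.sqrt (2 * γ * T_L)| + |Real.sqrt (2 * γ * T_R)| + 1) ^ 4 / K ≤ 16 * cs ^ 4 / K :=
      div_le_div_of_nonneg_right (by linarith only [h1]) hK0.le
    have h3 : y₀ ≤ κ₀ / (2 * Real.exp (θ * γ * (T_L + T_R) * tstar)) := by
      rw [hy₀]
      exact div_le_div_of_nonneg_left hκ₀0.le (by positivity) (by linarith only [hGle])
    have h4 : x₀ ≤ (κ₀ / (2 * Real.exp (θ * γ * (T_L + T_R) * tstar))) ^ (1 - p⁻¹)⁻¹ := by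
      rw [hx₀]
      exact Real.rpow_le_rpow hy₀0.le h3 (inv_pos.2 hr0).le
    exact h2.trans (hbadK.trans h4)
  have hMeI : 2 * CI ≤ εI * M := by
    have h1 : 2 * CI / εI ≤ M := by rw [hM, Real.le_sqrt (by positivity) hK0.le]; exact hKeI
    rw [div_le_iff₀ hεI] at h1
    linarith only [h1]
  have hMeII : 2 * CI ≤ εII * M := by
    have h1 : 2 * CI / εII ≤ M := by rw [hM, Real.le_sqrt (by positivity) hK0.le]; exact hKeII
    rw [div_le_iff₀ hεII] at h1
    linarith only [h1]
  have hK2 : K ≤ K ^ 2 := by nlinarith only [hK1]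
  have hK3 : K ^ 2 ≤ K ^ 3 := by nlinarith only [hK1, hK2]
  have hKMK : K ≤ M * K ^ 2 := by nlinarith only [hM1, hK2, hK0]
  -- the interaction-regime window (used for `lam > 0`, and for `lam = 0` when `Ĥ ≥ 1/2`)
  have hwinI : 1 / 2 ≤ (limitChain lam β).hamiltonian N (rescale K z) →
      ∃ w : ℝ≥0, w ≤ tstar ∧
        ∫⁻ y, ENNReal.ofReal (Real.exp (θ * (pinnedChain ω₂ lam β γ).hamiltonian N y))
            ∂((pinnedChain ω₂ lam β γ).transitionKernel N T_L T_R w z) ≤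
          ENNReal.ofReal (κ₀ * Real.exp (θ * (pinnedChain ω₂ lam β γ).hamiltonian N z)) := by
    intro hreg
    have hwt : 1 / K ≤ (tstar : ℝ) := by rw [one_div_le hK0 hts0]; exact hKt
    refine pinnedChain_window_decay_of_dissipation hω hl hβ hγ hN hTL hTR hθ hp1 hpθ' tstar (K := K)
      (wr := 1 / K) (Dis := εI * K ^ 3) (κ₀ := κ₀) hK1 (by positivity)
      (by rw [div_le_one hK0]; exact hK1) hwt hκ₀0 hz2 ?_ ?_ ?_ ?_ hKcs' hbadK'
    · -- `A √K (1/K) ≤ K`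
      rw [← hA, ← hM]
      calc A * M * (1 / K) ≤ A * M * 1 := by
            refine mul_le_mul_of_nonneg_left ?_ (by positivity)
            rw [div_le_one hK0]; exact hK1
        _ ≤ K := by rw [mul_one]; exact hAM
    · intro η hη hηb
      exact hI K hKI z hz2 hreg η hη fun s hs => (hηb s hs).trans (by rw [← hM]; exact hMδ)
    · -- the energy error over the window `1/K` is `≤ CI √K K² ≤ εI K³/2`
      rw [← hA, ← hc₁, ← hB, ← hM]
      have e1 : 1 / K * M * ((A * c₁ + B) * K ^ 3) = M * (A * c₁ + B) * K ^ 2 := by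
        field_simp
      have e2 : N * M * ((c₁ + 1 / 2) * K ^ 2 + M / 2) = N * M * (c₁ + 1 / 2) * K ^ 2 + N * K / 2 := by
        rw [mul_add, show (N : ℝ) * M * (M / 2) = N * (M * M) / 2 by ring, hMK]; ring
      rw [e1, e2]
      have h3 : N * K / 2 ≤ N / 2 * M * K ^ 2 := by
        have := mul_le_mul_of_nonneg_left hKMK (by positivity : (0 : ℝ) ≤ N / 2)
        linarith only [this]
      have h4 : M * (A * c₁ + B) * K ^ 2 + N * M * (c₁ + 1 / 2) * K ^ 2 + N / 2 * M * K ^ 2 = CI * M * K ^ 2 := by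
        rw [hCI]; ring
      have h5 : CI * M * K ^ 2 ≤ εI * K ^ 3 / 2 := by
        have h6 : CI * M ≤ εI * (M * M) / 2 := by nlinarith only [hMeI, hM0]
        rw [hMK] at h6
        have h7 := mul_le_mul_of_nonneg_right h6 (sq_nonneg K)
        have e : εI * K / 2 * K ^ 2 = εI * K ^ 3 / 2 := by ring
        linarith only [h7, e]
      linarith only [h3, h4, h5]
    · -- `log(2/κ₀) ≤ θ εI K³/2`
      have h1 : 2 * L₀ ≤ θ * εI * K := by
        have := hKLI
        rw [div_le_iff₀ (by positivity)] at this
        linarith only [this]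
      have h2 : K ≤ K ^ 3 := hK2.trans hK3
      have h3 := mul_le_mul_of_nonneg_left h2 (by positivity : 0 ≤ θ * εI)
      rw [← hL₀]
      linarith only [h1, h3]
  rcases hl.eq_or_lt with hl0 | hlpos
  · -- harmonic pinning `lam = 0`: interaction or pinning regime
    subst hl0
    by_cases hreg : 1 / 2 ≤ (limitChain 0 β).hamiltonian N (rescale K z)
    · exact hwinI hreg
    · push Not at hreg
      refine pinnedChain_window_decay_of_dissipation hω le_rfl hβ hγ hN hTL hTR hθ hp1 hpθ' tstar (K := K)
        (wr := T₂) (Dis := εII * K ^ 4) (κ₀ := κ₀) hK1 hT₂0 hT₂1 hT₂t hκ₀0 hz2 ?_ ?_ ?_ ?_ hKcs' hbadK'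
      · rw [← hA, ← hM]
        calc A * M * T₂ ≤ A * M * 1 := mul_le_mul_of_nonneg_left hT₂1 (by positivity)
          _ ≤ K := by rw [mul_one]; exact hAM
      · intro η hη hηb
        exact hII K hKII z hz1 hz2 hreg η hη fun s hs => (hηb s hs).trans (by rw [← hM]; exact hMδ)
      · rw [← hA, ← hc₁, ← hB, ← hM]
        have e2 : N * M * ((c₁ + 1 / 2) * K ^ 2 + M / 2) = N * M * (c₁ + 1 / 2) * K ^ 2 + N * K / 2 := by
          rw [mul_add, show (N : ℝ) * M * (M / 2) = N * (M * M) / 2 by ring, hMK]; ring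
        rw [e2]
        have h1 : T₂ * M * ((A * c₁ + B) * K ^ 3) ≤ M * (A * c₁ + B) * K ^ 3 := by
          have := mul_le_mul_of_nonneg_right hT₂1 (by positivity : 0 ≤ M * ((A * c₁ + B) * K ^ 3))
          linarith only [this]
        have h2 : N * M * (c₁ + 1 / 2) * K ^ 2 ≤ N * M * (c₁ + 1 / 2) * K ^ 3 :=
          mul_le_mul_of_nonneg_left hK3 (by positivity)
        have h3 : N * K / 2 ≤ N / 2 * M * K ^ 3 := by
          have := mul_le_mul_of_nonneg_left (hKMK.trans (mul_le_mul_of_nonneg_left hK3 hM0.le))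
            (by positivity : (0 : ℝ) ≤ N / 2)
          linarith only [this]
        have h4 : M * (A * c₁ + B) * K ^ 3 + N * M * (c₁ + 1 / 2) * K ^ 3 + N / 2 * M * K ^ 3 = CI * M * K ^ 3 := by
          rw [hCI]; ring
        have h5 : CI * M * K ^ 3 ≤ εII * K ^ 4 / 2 := by
          have h6 : CI * M ≤ εII * (M * M) / 2 := by nlinarith only [hMeII, hM0]
          rw [hMK] at h6
          have h7 := mul_le_mul_of_nonneg_right h6 (pow_nonneg hK0.le 3)
          have e : εII * K / 2 * K ^ 3 = εII * K ^ 4 / 2 := by ring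
          linarith only [h7, e]
        linarith only [h1, h2, h3, h4, h5]
      · have h1 : 2 * L₀ ≤ θ * εII * K := by
          have := hKLII
          rw [div_le_iff₀ (by positivity)] at this
          linarith only [this]
        have h2 : K ≤ K ^ 4 := (hK2.trans hK3).trans (by nlinarith only [hK1, hK3])
        have h3 := mul_le_mul_of_nonneg_left h2 (by positivity : 0 ≤ θ * εII)
        rw [← hL₀]
        linarith only [h1, h3]
  · -- quartic pinning `lam > 0`: always the interaction regime
    refine hwinI (limitChain_hamiltonian_ge_half_of_pos hω hlpos hβ hK1 ?_ hz1 hz2)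
    rw [← hCΦ]
    linarith only [hKΦ', hK2]

/-- **Remark 5.2 of CEHR, uniformly for baths at `0 < T_L, T_R ≤ Tmax`**: for `0 < θ < 1/Tmax` and
`t* > 0` there are ONE threshold `E₁` and ONE constant `c = e^{2θγ Tmax t*} e^{θE₁}` with the
geometric drift `P_{t*} e^{θH}(z) ≤ e^{θH(z)}/2 + c` for all `z` and all such bath temperatures (above
`E₁` the uniform decay `pinnedChain_decay_uniform`; below it the a-priori bound (3.4)
`P_t e^{θH} ≤ e^{θγ(T_L+T_R)t} e^{θH}`). [cite: CuneoEckmannHairerReyBellet2018, Rem 5.2] -/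
theorem pinnedChain_drift_uniform {θ : ℝ} (hθ : 0 < θ) (hθ' : θ < 1 / Tmax) (tstar : ℝ≥0)
    (htstar : 0 < tstar) :
    ∃ c : ℝ, 0 < c ∧ ∀ T_L T_R : ℝ, 0 < T_L → 0 < T_R → T_L ≤ Tmax → T_R ≤ Tmax →
      ∀ z : PhaseSpace N,
        ∫⁻ y, ENNReal.ofReal (Real.exp (θ * (pinnedChain ω₂ lam β γ).hamiltonian N y))
            ∂((pinnedChain ω₂ lam β γ).transitionKernel N T_L T_R tstar z) ≤
          ENNReal.ofReal (1 / 2 * Real.exp (θ * (pinnedChain ω₂ lam β γ).hamiltonian N z) + c) := by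
  obtain ⟨E₁, hE₁⟩ := pinnedChain_decay_uniform hω hl hβ hγ hN hTmax hθ hθ' tstar htstar
  set H := (pinnedChain ω₂ lam β γ).hamiltonian N with hH
  set c := Real.exp (θ * γ * (Tmax + Tmax) * tstar) * Real.exp (θ * E₁) with hc
  have hcpos : 0 < c := by positivity
  refine ⟨c, hcpos, fun T_L T_R hTL hTR hTLm hTRm z => ?_⟩
  have hmaxT : max T_L T_R ≤ Tmax := max_le hTLm hTRm
  have hmax0 : 0 < max T_L T_R := lt_max_of_lt_left hTL
  have hθ'' : θ < 1 / max T_L T_R := hθ'.trans_le (one_div_le_one_div_of_le hmax0 hmaxT)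
  by_cases hz : E₁ ≤ H z
  · refine (hE₁ T_L T_R hTL hTR hTLm hTRm z hz).trans (ENNReal.ofReal_le_ofReal ?_)
    linarith
  · refine (lintegral_exp_mul_hamiltonian_pinnedChainSemigroup_le hω hl hβ.le hγ.le hN hTL.le hTR.le
      hTL hTR hθ hθ'' tstar z).trans (ENNReal.ofReal_le_ofReal ?_)
    have h1 : Real.exp (θ * H z) ≤ Real.exp (θ * E₁) :=
      Real.exp_le_exp.2 (mul_le_mul_of_nonneg_left (le_of_lt (not_le.1 hz)) hθ.le)
    have hsum : T_L + T_R ≤ Tmax + Tmax := add_le_add hTLm hTRm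
    have h0 : Real.exp (θ * γ * (T_L + T_R) * tstar) ≤ Real.exp (θ * γ * (Tmax + Tmax) * tstar) := by
      refine Real.exp_le_exp.2 (mul_le_mul_of_nonneg_right (mul_le_mul_of_nonneg_left hsum ?_) tstar.coe_nonneg)
      positivity
    have h2 : Real.exp (θ * γ * (T_L + T_R) * tstar) * Real.exp (θ * H z) ≤ c :=
      mul_le_mul h0 h1 (Real.exp_pos _).le (Real.exp_pos _).le
    have h3 : 0 ≤ 1 / 2 * Real.exp (θ * H z) := by positivity
    linarith

end Uniform

end Summit.AtomisticToContinuum.FouriersLaw.Theorems.OddSectorIrreversibility.Corrector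

end
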